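import Summits.RiemannHypothesis.RiemannHypothesis.Theses.WeilComb
import Summits.RiemannHypothesis.RiemannHypothesis.Theorems.CombSubcritical.Negative.WeilCombCombSubcriticalLoadBearing
import Literature.NumberTheory.LFunctions.WeilExplicit
import Literature.NumberTheory.LFunctions.WeilExplicitContinuous
import Literature.NumberTheory.LFunctions.WeilArchimedeanMoments
import Literature.NumberTheory.LFunctions.WeilArchimedeanPositivityProofs
import Literature.NumberTheory.LFunctions.WeilMellinBounds
import Literature.NumberTheory.LFunctions.WeilWindowSimpleEven
import Literature.NumberTheory.LFunctions.WeilGroundEnergyProofs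

/-!
# Stub `stub_prime` of line `helson-dirichlet-slack` for crux `WeilComb.CombSubcritical`
(item stmt-RiemannHypothesis-1025, route route-RiemannHypothesis-WeilComb)

The prime term of the comb autocorrelation is EXACT. Let `φ` be a Weil test function with
`tsupport φ ⊆ [-1, 1]`, `ε > 0`, `φ_ε = ε⁻¹ φ(·/ε)`, `ψ_ε = φ_ε ⋆ φ̃_ε` and let
`g(x) = Σ_{m ≤ M} a_m φ_ε(x − log m)` be a log-integer comb with `M ≥ 1` and `8 ε M ≤ 1`.
Granted the autocorrelation identity `g ⋆ g̃ = K`,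
`K(t) = Σ_{m, m' ≤ M} a_m conj(a_{m'}) ψ_ε(t − (log m − log m'))` (the hypothesis, Stub 4 of the
line), we prove

`Σ_n Λ(n) n^{-1/2} (K(log n) + K(−log n)) = ε⁻¹ ‖φ‖₂² · 2 Re Σ_{m ≤ M} Σ_{n ≤ M/m} Λ(n) n^{-1/2} a(nm) conj a(m)`,

i.e. `weilPrimeTerm (g ⋆ g̃) = ψ_ε(0) ⟨S_M a, a⟩`.

Proof sketch.
* `tsupport ψ_ε ⊆ [−2ε, 2ε]` (`tsupport_weilConv_weilReflect_subset`), so `ψ_ε(s) = 0` for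
  `|s| > 2ε`; and `ψ_ε(0) = ‖φ_ε‖₂² = ε⁻¹ ‖φ‖₂²` (`weilConv_weilReflect_apply_zero` and the
  dilation `Measure.integral_comp_div`).
* Diophantine gap: for distinct positive integers `p ≠ q` with `min(p, q) ≤ M`,
  `|log p − log q| ≥ log(1 + 1/min(p,q)) ≥ 1/(min(p,q) + 1) ≥ 1/(M + 1) > 2ε` (as `8εM ≤ 1`,
  `M ≥ 1`), hence `ψ_ε(log p − log q) = 0`.
* Consequently, for `n ≥ 1`, in `K(log n) = Σ_{m,m'} a_m conj(a_{m'}) ψ_ε(log(n m') − log m)`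
  only `m = n m'` survives: `K(log n) = ψ_ε(0) Σ_{m' ≤ M/n} a(n m') conj a(m')`, and likewise
  `K(−log n) = ψ_ε(0) Σ_{m ≤ M/n} a(m) conj a(n m)`; both vanish for `n > M`, and `Λ(0) = 0`,
  so the prime sum is the finite sum over `1 ≤ n ≤ M` (`tsum_eq_sum`).
* Finally `z + conj z = 2 Re z`, `Λ(n) n^{-1/2}` is real, and the index sets
  `{1 ≤ n ≤ M, 1 ≤ m ≤ M/n}` and `{1 ≤ m ≤ M, 1 ≤ n ≤ M/m}` coincide (`Finset.sum_comm'`).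
-/

noncomputable section

open scoped BigOperators ComplexConjugate
open Complex MeasureTheory Set

namespace Summit.RiemannHypothesis.RiemannHypothesis.Theorems.WeilCombSubcritical

open Literature.NumberTheory.LFunctions

/-! ### Private toolkit: the dilate `φ_ε` and the kernel `ψ_ε = φ_ε ⋆ φ̃_ε` -/

/-- `φ_ε` is a Weil test function (`ε ≠ 0`). -/
private theorem isWeilTest_dil_prime {φ : ℝ → ℂ} {ε : ℝ} (hφ : IsWeilTest φ) (hε : ε ≠ 0) :
    IsWeilTest (fun t : ℝ => (ε : ℂ)⁻¹ * φ (t / ε)) := by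
  have h1 : IsWeilTest (fun t : ℝ => φ (t / ε)) := by
    refine ⟨hφ.1.comp (contDiff_id.div_const ε), ?_⟩
    have e : (fun t : ℝ => φ (t / ε)) = φ ∘ (Homeomorph.mulRight₀ ε⁻¹ (inv_ne_zero hε)) := by
      ext t
      simp [div_eq_mul_inv]
    rw [e]
    exact hφ.2.comp_homeomorph _
  exact h1.const_mul _

/-- `tsupport φ ⊆ [-1, 1]` gives `tsupport φ_ε ⊆ [-ε, ε]` (`ε > 0`). -/
private theorem tsupport_dil_subset_prime {φ : ℝ → ℂ} {ε : ℝ} (hsupp : tsupport φ ⊆ Icc (-1) 1)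
    (hε : 0 < ε) : tsupport (fun t : ℝ => (ε : ℂ)⁻¹ * φ (t / ε)) ⊆ Icc (-ε) ε := by
  refine closure_minimal ?_ isClosed_Icc
  intro t ht
  rw [Function.mem_support] at ht
  have hφ : φ (t / ε) ≠ 0 := fun h => ht (by simp [h])
  have hmem : t / ε ∈ Icc (-1 : ℝ) 1 := hsupp (subset_tsupport _ hφ)
  constructor
  · have h := hmem.1
    rw [le_div_iff₀ hε] at h
    linarith
  · have h := hmem.2
    rw [div_le_iff₀ hε] at h
    linarith

/-- `ψ_ε(s) = 0` for `|s| > 2ε`. -/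
private theorem psi_eq_zero_prime {φ : ℝ → ℂ} {ε : ℝ} (hφ : IsWeilTest φ)
    (hsupp : tsupport φ ⊆ Icc (-1) 1) (hε : 0 < ε) {s : ℝ} (hs : 2 * ε < |s|) :
    weilConv (fun t : ℝ => (ε : ℂ)⁻¹ * φ (t / ε))
        (weilReflect (fun t : ℝ => (ε : ℂ)⁻¹ * φ (t / ε))) s = 0 := by
  have hsub : tsupport (weilConv (fun t : ℝ => (ε : ℂ)⁻¹ * φ (t / ε))
      (weilReflect (fun t : ℝ => (ε : ℂ)⁻¹ * φ (t / ε)))) ⊆ Icc (-(2 * ε)) (2 * ε) :=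
    tsupport_weilConv_weilReflect_subset (isWeilTest_dil_prime hφ hε.ne').2
      (tsupport_dil_subset_prime hsupp hε)
  refine eq_zero_of_tsupport_subset hsub fun h => ?_
  have h1 := h.1
  have h2 := h.2
  have : |s| ≤ 2 * ε := abs_le.2 ⟨h1, h2⟩
  linarith

/-- `ψ_ε(0) = ‖φ_ε‖₂² = ε⁻¹ ‖φ‖₂²` (`ε > 0`). -/
private theorem psi_zero_prime (φ : ℝ → ℂ) {ε : ℝ} (hε : 0 < ε) :
    weilConv (fun t : ℝ => (ε : ℂ)⁻¹ * φ (t / ε))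
        (weilReflect (fun t : ℝ => (ε : ℂ)⁻¹ * φ (t / ε))) 0 = ((ε⁻¹ * weilNorm2Sq φ : ℝ) : ℂ) := by
  rw [weilConv_weilReflect_apply_zero]
  congr 1
  show (∫ t : ℝ, ‖(ε : ℂ)⁻¹ * φ (t / ε)‖ ^ 2) = ε⁻¹ * weilNorm2Sq φ
  have e : (fun t : ℝ => ‖(ε : ℂ)⁻¹ * φ (t / ε)‖ ^ 2) = fun t => ε⁻¹ ^ 2 * ‖φ (t / ε)‖ ^ 2 := by
    funext t
    rw [norm_mul, norm_inv, Complex.norm_real, Real.norm_eq_abs, abs_of_pos hε, mul_pow]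
  rw [e, integral_const_mul, Measure.integral_comp_div (fun t => ‖φ t‖ ^ 2) ε, abs_of_pos hε,
    smul_eq_mul]
  unfold weilNorm2Sq
  rw [← mul_assoc, sq, mul_assoc ε⁻¹, inv_mul_cancel₀ hε.ne', mul_one]

/-! ### The Diophantine gap between logarithms of integers -/

/-- For positive integers `p < q`: `log q − log p ≥ log(1 + 1/p) ≥ 1/(p + 1)`. -/
private theorem log_gap_prime {p q : ℕ} (hp : 1 ≤ p) (hpq : p < q) :
    1 / ((p : ℝ) + 1) ≤ Real.log q - Real.log p := by
  have hp0 : (0 : ℝ) < p := Nat.cast_pos.2 hp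
  have hp1 : (0 : ℝ) < p + 1 := by linarith
  have hq : (p : ℝ) + 1 ≤ q := by exact_mod_cast Nat.succ_le_of_lt hpq
  have h1 : Real.log ((p : ℝ) + 1) ≤ Real.log q := Real.log_le_log hp1 hq
  have h3 := Real.one_sub_inv_le_log_of_pos (div_pos hp1 hp0)
  rw [Real.log_div hp1.ne' hp0.ne', inv_div] at h3
  have e : (1 : ℝ) / (p + 1) = 1 - p / (p + 1) := by
    field_simp
    ring
  linarith

/-- For distinct positive integers `p ≠ q` with `min(p, q) ≤ M`: `1/(M + 1) ≤ |log p − log q|`. -/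
private theorem abs_log_sub_log_prime {p q M : ℕ} (hp : 1 ≤ p) (hq : 1 ≤ q) (hpq : p ≠ q)
    (hmin : p ≤ M ∨ q ≤ M) : 1 / ((M : ℝ) + 1) ≤ |Real.log p - Real.log q| := by
  rcases lt_or_gt_of_ne hpq with h | h
  · have hpM : p ≤ M := hmin.elim id fun hqM => h.le.trans hqM
    have hpM' : (p : ℝ) + 1 ≤ (M : ℝ) + 1 := by
      have : (p : ℝ) ≤ M := by exact_mod_cast hpM
      linarith
    have hg := log_gap_prime hp h
    have hpos : (0 : ℝ) < 1 / ((p : ℝ) + 1) := by positivity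
    rw [abs_sub_comm, abs_of_pos (hpos.trans_le hg)]
    exact (one_div_le_one_div_of_le (by positivity) hpM').trans hg
  · have hqM : q ≤ M := hmin.elim (fun hpM => h.le.trans hpM) id
    have hqM' : (q : ℝ) + 1 ≤ (M : ℝ) + 1 := by
      have : (q : ℝ) ≤ M := by exact_mod_cast hqM
      linarith
    have hg := log_gap_prime hq h
    have hpos : (0 : ℝ) < 1 / ((q : ℝ) + 1) := by positivity
    rw [abs_of_pos (hpos.trans_le hg)]
    exact (one_div_le_one_div_of_le (by positivity) hqM').trans hg

/-- Under `M ≥ 1`, `8εM ≤ 1`: `ψ_ε(log p − log q) = 0` for distinct positive integers `p ≠ q`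
with `min(p, q) ≤ M` (the gap `1/(M+1)` beats the support radius `2ε`). -/
private theorem psi_log_sub_log_eq_zero_prime {φ : ℝ → ℂ} {ε : ℝ} (hφ : IsWeilTest φ)
    (hsupp : tsupport φ ⊆ Icc (-1) 1) (hε : 0 < ε) {M : ℕ} (hM : 1 ≤ M) (h8 : 8 * ε * M ≤ 1)
    {p q : ℕ} (hp : 1 ≤ p) (hq : 1 ≤ q) (hpq : p ≠ q) (hmin : p ≤ M ∨ q ≤ M) :
    weilConv (fun t : ℝ => (ε : ℂ)⁻¹ * φ (t / ε))
        (weilReflect (fun t : ℝ => (ε : ℂ)⁻¹ * φ (t / ε))) (Real.log p - Real.log q) = 0 := by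
  refine psi_eq_zero_prime hφ hsupp hε
    (lt_of_lt_of_le ?_ (abs_log_sub_log_prime hp hq hpq hmin))
  have hM' : (1 : ℝ) ≤ M := by exact_mod_cast hM
  have hMpos : (0 : ℝ) < (M : ℝ) + 1 := by linarith
  rw [lt_div_iff₀ hMpos]
  have h1 : ε ≤ ε * M := le_mul_of_one_le_right hε.le hM'
  linarith

/-! ### Combinatorics of the comb kernel -/

/-- `[1, M/n] = {m ∈ [1, M] : n m ≤ M}` for `n ≥ 1`. -/
private theorem Icc_div_eq_filter_prime {M n : ℕ} (hn : 1 ≤ n) :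
    Finset.Icc 1 (M / n) = (Finset.Icc 1 M).filter (fun m => n * m ≤ M) := by
  ext m
  simp only [Finset.mem_filter, Finset.mem_Icc]
  constructor
  · rintro ⟨h1, h2⟩
    have h3 : m * n ≤ M := (Nat.le_div_iff_mul_le hn).1 h2
    refine ⟨⟨h1, le_trans (Nat.le_mul_of_pos_right m hn) h3⟩, ?_⟩
    rwa [mul_comm] at h3
  · rintro ⟨⟨h1, -⟩, h3⟩
    exact ⟨h1, (Nat.le_div_iff_mul_le hn).2 (by rwa [mul_comm] at h3)⟩

/-- Swapping the order of summation over the pairs `n m ≤ M`, `n, m ≥ 1`. -/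
private theorem sum_div_swap_prime (M : ℕ) (f : ℕ → ℕ → ℂ) :
    ∑ n ∈ Finset.Icc 1 M, ∑ m ∈ Finset.Icc 1 (M / n), f n m =
      ∑ m ∈ Finset.Icc 1 M, ∑ n ∈ Finset.Icc 1 (M / m), f n m := by
  refine Finset.sum_comm' fun n m => ?_
  simp only [Finset.mem_Icc]
  constructor
  · rintro ⟨⟨hn1, -⟩, hm1, hmM⟩
    have h : m * n ≤ M := (Nat.le_div_iff_mul_le hn1).1 hmM
    refine ⟨⟨hn1, (Nat.le_div_iff_mul_le hm1).2 (by rwa [mul_comm] at h)⟩, hm1,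
      le_trans (Nat.le_mul_of_pos_right m hn1) h⟩
  · rintro ⟨⟨hn1, hnM⟩, hm1, -⟩
    have h : n * m ≤ M := (Nat.le_div_iff_mul_le hm1).1 hnM
    refine ⟨⟨hn1, le_trans (Nat.le_mul_of_pos_right n hm1) h⟩, hm1,
      (Nat.le_div_iff_mul_le hn1).2 (by rwa [mul_comm] at h)⟩

/-- `K(log n) = ψ(0) Σ_{m' ≤ M/n} a(n m') conj a(m')` for `n ≥ 1`, whenever `ψ(log p − log q) = 0`
for all distinct positive integers `p ≠ q` with `min(p, q) ≤ M`. -/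
private theorem comb_kernel_log_prime {ψ : ℝ → ℂ} {M : ℕ} (a : ℕ → ℂ)
    (hvan : ∀ p q : ℕ, 1 ≤ p → 1 ≤ q → p ≠ q → (p ≤ M ∨ q ≤ M) →
      ψ (Real.log p - Real.log q) = 0)
    {n : ℕ} (hn : 1 ≤ n) :
    ∑ m ∈ Finset.Icc 1 M, ∑ m' ∈ Finset.Icc 1 M,
        a m * conj (a m') * ψ (Real.log n - (Real.log m - Real.log m')) =
      ψ 0 * ∑ m' ∈ Finset.Icc 1 (M / n), a (n * m') * conj (a m') := by
  have hn0 : (n : ℝ) ≠ 0 := (Nat.cast_pos.2 hn).ne'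
  rw [Finset.sum_comm, Finset.mul_sum, Icc_div_eq_filter_prime hn, Finset.sum_filter]
  refine Finset.sum_congr rfl fun m' hm' => ?_
  have hm'1 : 1 ≤ m' := (Finset.mem_Icc.1 hm').1
  have hm'0 : (m' : ℝ) ≠ 0 := (Nat.cast_pos.2 hm'1).ne'
  have e : ∀ m : ℕ, Real.log n - (Real.log m - Real.log m') =
      Real.log ((n * m' : ℕ) : ℝ) - Real.log m := fun m => by
    rw [Nat.cast_mul, Real.log_mul hn0 hm'0]
    ring
  split_ifs with hnm
  · rw [Finset.sum_eq_single_of_mem (n * m') (Finset.mem_Icc.2 ⟨Nat.mul_pos hn hm'1, hnm⟩) ?_]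
    · rw [e, sub_self]
      ring
    · intro m hm hne
      rw [e, hvan (n * m') m (Nat.mul_pos hn hm'1) (Finset.mem_Icc.1 hm).1 (Ne.symm hne)
        (Or.inr (Finset.mem_Icc.1 hm).2), mul_zero]
  · refine Finset.sum_eq_zero fun m hm => ?_
    have hmM : m ≤ M := (Finset.mem_Icc.1 hm).2
    have hne : n * m' ≠ m := fun h => hnm (h ▸ hmM)
    rw [e, hvan (n * m') m (Nat.mul_pos hn hm'1) (Finset.mem_Icc.1 hm).1 hne (Or.inr hmM),
      mul_zero]

/-- `K(−log n) = ψ(0) Σ_{m ≤ M/n} a(m) conj a(n m)` for `n ≥ 1`, under the same vanishing. -/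
private theorem comb_kernel_neg_log_prime {ψ : ℝ → ℂ} {M : ℕ} (a : ℕ → ℂ)
    (hvan : ∀ p q : ℕ, 1 ≤ p → 1 ≤ q → p ≠ q → (p ≤ M ∨ q ≤ M) →
      ψ (Real.log p - Real.log q) = 0)
    {n : ℕ} (hn : 1 ≤ n) :
    ∑ m ∈ Finset.Icc 1 M, ∑ m' ∈ Finset.Icc 1 M,
        a m * conj (a m') * ψ (-Real.log n - (Real.log m - Real.log m')) =
      ψ 0 * ∑ m ∈ Finset.Icc 1 (M / n), a m * conj (a (n * m)) := by
  have hn0 : (n : ℝ) ≠ 0 := (Nat.cast_pos.2 hn).ne'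
  rw [Finset.mul_sum, Icc_div_eq_filter_prime hn, Finset.sum_filter]
  refine Finset.sum_congr rfl fun m hm => ?_
  have hm1 : 1 ≤ m := (Finset.mem_Icc.1 hm).1
  have hm0 : (m : ℝ) ≠ 0 := (Nat.cast_pos.2 hm1).ne'
  have e : ∀ m' : ℕ, -Real.log n - (Real.log m - Real.log m') =
      Real.log m' - Real.log ((n * m : ℕ) : ℝ) := fun m' => by
    rw [Nat.cast_mul, Real.log_mul hn0 hm0]
    ring
  split_ifs with hnm
  · rw [Finset.sum_eq_single_of_mem (n * m) (Finset.mem_Icc.2 ⟨Nat.mul_pos hn hm1, hnm⟩) ?_]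
    · rw [e, sub_self]
      ring
    · intro m' hm' hne
      rw [e, hvan m' (n * m) (Finset.mem_Icc.1 hm').1 (Nat.mul_pos hn hm1) hne
        (Or.inl (Finset.mem_Icc.1 hm').2), mul_zero]
  · refine Finset.sum_eq_zero fun m' hm' => ?_
    have hm'M : m' ≤ M := (Finset.mem_Icc.1 hm').2
    have hne : m' ≠ n * m := fun h => hnm (h ▸ hm'M)
    rw [e, hvan m' (n * m) (Finset.mem_Icc.1 hm').1 (Nat.mul_pos hn hm1) hne (Or.inl hm'M),
      mul_zero]

/-- The prime term of the comb kernel `K = Σ_{m,m'} a_m conj(a_{m'}) τ_{log m − log m'} ψ` when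
`ψ(log p − log q) = 0` for all distinct positive integers `p ≠ q` with `min(p, q) ≤ M`:
a finite sum over `1 ≤ n ≤ M`. -/
private theorem weilPrimeTerm_comb_kernel_prime {ψ : ℝ → ℂ} {M : ℕ} (a : ℕ → ℂ)
    (hvan : ∀ p q : ℕ, 1 ≤ p → 1 ≤ q → p ≠ q → (p ≤ M ∨ q ≤ M) →
      ψ (Real.log p - Real.log q) = 0) :
    weilPrimeTerm (fun t : ℝ => ∑ m ∈ Finset.Icc 1 M, ∑ m' ∈ Finset.Icc 1 M,
        a m * conj (a m') * weilTranslate ψ (Real.log (m : ℝ) - Real.log (m' : ℝ)) t) =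
      ψ 0 * ∑ n ∈ Finset.Icc 1 M,
        ((ArithmeticFunction.vonMangoldt n : ℝ) : ℂ) / (Real.sqrt n : ℂ) *
          ∑ m ∈ Finset.Icc 1 (M / n), (a (n * m) * conj (a m) + a m * conj (a (n * m))) := by
  unfold weilPrimeTerm
  simp only [weilTranslate]
  refine (tsum_eq_sum (s := Finset.Icc 1 M) fun n hn => ?_).trans ?_
  · rcases Nat.eq_zero_or_pos n with rfl | hpos
    · simp
    · have hMn : M < n := by
        by_contra h
        exact hn (Finset.mem_Icc.2 ⟨hpos, not_lt.1 h⟩)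
      rw [comb_kernel_log_prime a hvan hpos, comb_kernel_neg_log_prime a hvan hpos,
        Nat.div_eq_of_lt hMn]
      simp
  · rw [Finset.mul_sum]
    refine Finset.sum_congr rfl fun n hn => ?_
    have hn1 : 1 ≤ n := (Finset.mem_Icc.1 hn).1
    rw [comb_kernel_log_prime a hvan hn1, comb_kernel_neg_log_prime a hvan hn1, ← mul_add,
      ← Finset.sum_add_distrib]
    ring

/-- Final bookkeeping: with `c_n = Λ(n) n^{-1/2}` (real) and `z_{n,m} = a(nm) conj a(m)`,
`Σ_{n ≤ M} c_n Σ_{m ≤ M/n} (z_{n,m} + conj z_{n,m}) = 2 Re Σ_{m ≤ M} Σ_{n ≤ M/m} c_n z_{n,m}`. -/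
private theorem prime_sum_swap_prime (M : ℕ) (a : ℕ → ℂ) :
    ∑ n ∈ Finset.Icc 1 M, ((ArithmeticFunction.vonMangoldt n : ℝ) : ℂ) / (Real.sqrt n : ℂ) *
        ∑ m ∈ Finset.Icc 1 (M / n), (a (n * m) * conj (a m) + a m * conj (a (n * m))) =
      ((2 * (∑ m ∈ Finset.Icc 1 M, ∑ n ∈ Finset.Icc 1 (M / m),
        ((ArithmeticFunction.vonMangoldt n : ℝ) : ℂ) / (Real.sqrt n : ℂ) * a (n * m) *
          conj (a m)).re : ℝ) : ℂ) := by
  have hc : ∀ n : ℕ, conj (((ArithmeticFunction.vonMangoldt n : ℝ) : ℂ) / (Real.sqrt n : ℂ)) =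
      ((ArithmeticFunction.vonMangoldt n : ℝ) : ℂ) / (Real.sqrt n : ℂ) := fun n => by
    rw [map_div₀, Complex.conj_ofReal, Complex.conj_ofReal]
  simp_rw [Finset.mul_sum]
  conv_lhs => rw [sum_div_swap_prime]
  rw [← Complex.add_conj, map_sum, ← Finset.sum_add_distrib]
  refine Finset.sum_congr rfl fun m _ => ?_
  rw [map_sum, ← Finset.sum_add_distrib]
  refine Finset.sum_congr rfl fun n _ => ?_
  rw [map_mul, map_mul, hc, Complex.conj_conj]
  ring

/-- **Stub 7b — the prime term of the comb autocorrelation is EXACT.**  From the autocorrelation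
(Stub 4): for a Weil test `φ` supported in `[-1, 1]`, `0 < ε`, `M ≥ 1`, `8εM ≤ 1`,
`Σₙ Λ(n) n^{-1/2} (k(log n) + k(−log n)) = ε⁻¹ ‖φ‖₂² ⟨S_M a, a⟩`, `k = g ⋆ g̃`: the lag
`log n − log m + log m'` lies in `supp ψ_ε ⊆ [−2ε, 2ε]` only when `n m' = m` (distinct positive
integers `p ≠ q` with `q ≤ M` have `|log p − log q| ≥ log(1 + 1/M) > 1/(4M) ≥ 2ε`), and
`ψ_ε(0) = ‖φ_ε‖₂² = ε⁻¹ ‖φ‖₂²`. -/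
theorem stub_prime :
    (∀ φ : ℝ → ℂ, IsWeilTest φ → ∀ ε : ℝ, 0 < ε → ∀ (M : ℕ) (a : ℕ → ℂ),
      weilConv (fun x : ℝ => ∑ m ∈ Finset.Icc 1 M, a m * ((ε : ℂ)⁻¹ * φ ((x - Real.log (m : ℝ)) / ε)))
          (weilReflect (fun x : ℝ => ∑ m ∈ Finset.Icc 1 M,
            a m * ((ε : ℂ)⁻¹ * φ ((x - Real.log (m : ℝ)) / ε)))) =
        fun t : ℝ => ∑ m ∈ Finset.Icc 1 M, ∑ m' ∈ Finset.Icc 1 M,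
          a m * conj (a m') *
            weilTranslate (weilConv (fun t : ℝ => (ε : ℂ)⁻¹ * φ (t / ε))
              (weilReflect (fun t : ℝ => (ε : ℂ)⁻¹ * φ (t / ε))))
              (Real.log (m : ℝ) - Real.log (m' : ℝ)) t) →
    ∀ φ : ℝ → ℂ, IsWeilTest φ → tsupport φ ⊆ Set.Icc (-1) 1 →
      ∀ ε : ℝ, 0 < ε → ∀ (M : ℕ) (a : ℕ → ℂ), 1 ≤ M → 8 * ε * M ≤ 1 →
        weilPrimeTerm
            (weilConv (fun x : ℝ => ∑ m ∈ Finset.Icc 1 M,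
                a m * ((ε : ℂ)⁻¹ * φ ((x - Real.log (m : ℝ)) / ε)))
              (weilReflect (fun x : ℝ => ∑ m ∈ Finset.Icc 1 M,
                a m * ((ε : ℂ)⁻¹ * φ ((x - Real.log (m : ℝ)) / ε))))) =
          ((ε⁻¹ * weilNorm2Sq φ *
              (2 * (∑ m ∈ Finset.Icc 1 M, ∑ n ∈ Finset.Icc 1 (M / m),
                ((ArithmeticFunction.vonMangoldt n : ℝ) : ℂ) / (Real.sqrt n : ℂ) * a (n * m) *
                  conj (a m)).re) : ℝ) : ℂ) := by
  intro hA φ hφ hsupp ε hε M a hM h8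
  rw [hA φ hφ ε hε M a]
  have hvan : ∀ p q : ℕ, 1 ≤ p → 1 ≤ q → p ≠ q → (p ≤ M ∨ q ≤ M) →
      weilConv (fun t : ℝ => (ε : ℂ)⁻¹ * φ (t / ε))
        (weilReflect (fun t : ℝ => (ε : ℂ)⁻¹ * φ (t / ε))) (Real.log p - Real.log q) = 0 :=
    fun p q hp hq hpq hmin => psi_log_sub_log_eq_zero_prime hφ hsupp hε hM h8 hp hq hpq hmin
  rw [weilPrimeTerm_comb_kernel_prime a hvan, psi_zero_prime φ hε, prime_sum_swap_prime M a,
    ← Complex.ofReal_mul]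

end Summit.RiemannHypothesis.RiemannHypothesis.Theorems.WeilCombSubcritical

end
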